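import Summits.Ventures.HSemireg.WedgeWeilDegRank

/-!
# Venture HSemireg — THEOREM R-B in the wedge model (9/9)

HONEST FRAMING. Part of the Lean index of the computation cell `pub-hsemireg` (seat p3; Sunday enclosure of the
FORMULA-N kernel assets of seats th-7 / th-6, ENCLOSURE-PLAN-p3.md).  Finite-dimensional exterior algebra over a field ONLY:
no variety, no cohomology theory, no semiregularity map is constructed here; nothing here says that HC / HC_CM / HC_AV holds;
no Literature fact is declared or used.  The geometric DICTIONARY (why these ranks are the `HT`-side box ranks of the cell's
STRUCTURE.md §1 / theory/FORMULA-N.md) lives in theory/FORMULA-N-th7.md PART B §A.3 / §N and is NOT asserted in Lean.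

THEOREM R-B (FORMULA-N PART B §L.3 / §L.8; STRUCTURE D9, (F1) Weil-frame clause, C16) in the SIGN-FREE transposed wedge model — theory/th7/WeilRank.lean v3 sha256/16 7e5d6bad1a94e25a (th-7 g4, 18:46Z; ×2 farm th-2 g20 18:48:20Z); PART R/R2/R3 = l.1506–3436 on top of HankelRank v1 (= the tree's Wedge/WedgeHankel* files), VERBATIM up
to namespaces (`HSemiregWeil` ↦ `Summit.Ventures.HSemireg.Wedge.Weil`, which sees the wedge-model infrastructure `….Wedge` and opens `….Wedge.Hankel`), file 9 of 9.
MODEL: `N` pairs of generators `x_c`, `y_c`; the h-part `f = w_N(q)` (HankelRank); the «Weil vectors» `w₊ = E_{G₋}`, `w₋ = E_{G₊}` = the full monomials on the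
generator blocks of the last `N − p` / first `p` pairs (signature `(p, N − p)`; THEOREM R is `N = 2n`, `p = n`).  HEADLINES (files 5, 8, 9): `weilRank` /
`weilRank_nn` («rank(⌟v ∣ HT²) = (4 + ρ)·n² − 2n», `v = f + a w₊ + b w₋`, `ab ≠ 0`, `n ≥ 3`, ρ = rank H₂(q)), `ker_eq` (kernel = mixed 2-forms killing `f`),
`weilRank_deg` / `weilRank_nn_deg` (every degree `m`, `m + 1 ≤ N − p`), `weilRank_one` / `weilRank_nn_one` (one-sided, ε = 1).  No permutation sign is evaluated
(the pair symmetries act through `AlternatingMap.map_perm`; `sgn κ` is a unit).  This file (PART R3): the ONE-SIDED case `v = f + a w₊` — `Hm`, `separation_one`, **`ker_eq_one`**, `HXm`, **`weilRank_one`** / **`weilRank_nn_one`** (`rank = C(2p,m) + (C(N,m) − C(p,m))·ρ_m`).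
-/

open Module Set Set.powersetCard Summit.Ventures.HSemireg.Wedge.Hankel

namespace Summit.Ventures.HSemireg.Wedge.Weil

variable (K : Type*) [Field K]

/-! ## PART R3 — THE ONE-SIDED CASE (one Weil vector, ε = 1; PART B §L.3 one-sided / WEIL-CONE-RANK ε = 1)
`rank(⌟(f + a·w₊) ∣ HT^m) = C(2p,m) + (C(N,m) − C(p,m))·ρ_m` for `m < N − p` (ε = 0 is THEOREM H itself). -/

section OneSided

variable (N : ℕ)

/-- `v = f + a·w₊` (only the Weil vector on the `G₋` block). -/
noncomputable def vW1 (p : ℕ) (q : ℕ → K) (a : K) : HT K (In N) := w K N N q + a • B K (In N) (Gm N p)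

/-- degree-`m` monomials meeting `G₋`. -/
def Half (m p : ℕ) (s : Finset (In N)) : Prop := s.card = m ∧ ¬ s ⊆ Dm N p

/-- the degree-`m` forms meeting `G₋`. -/
noncomputable def Hm (m p : ℕ) : Submodule K (HT K (In N)) := Sp K (Half N m p)

/-- `m`-sets of pairs meeting the last `N − p` pairs. -/
def HXm (m p : ℕ) : Finset (Finset (Fin N)) :=
  ((Finset.univ : Finset (Fin N)).powersetCard m).filter fun S => ¬ S ⊆ Ap N p

variable {N}

/-- `Hm ≤ Λ^m`. -/
lemma Hm_le_Hom (m p : ℕ) : Hm K N m p ≤ Hom K (In N) Finset.univ m :=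
  Sp_mono fun s hs => ⟨Finset.subset_univ s, hs.1⟩

/-- `θ ∧ v = θ ∧ f + a·(θ ∧ w₊)` (one-sided). -/
lemma vW1_mul_expand (p : ℕ) (q : ℕ → K) (a : K) (θ : HT K (In N)) :
    θ * vW1 K N p q a = θ * w K N N q + a • (θ * B K (In N) (Gm N p)) := by
  rw [vW1, mul_add, mul_smul_comm]

/-- weight separation (one-sided): `θ ∧ v = 0` forces `θ ∧ f = 0` and `θ ∧ w₊ = 0`. -/
lemma separation_one {m p : ℕ} (hm : m + 1 ≤ N - p) (q : ℕ → K) {a : K} {θ : HT K (In N)}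
    (hθ : θ ∈ Hom K (In N) Finset.univ m) (h0 : θ * vW1 K N p q a = 0) :
    θ * w K N N q = 0 ∧ (a ≠ 0 → θ * B K (In N) (Gm N p) = 0) := by
  classical
  have hp : p ≤ N := by omega
  have e0 := theta_mul_f_mem_deg K (m := m) (p := p) q hθ
  have e1 := theta_mul_wplus_mem_deg K (m := m) hp hθ
  rw [vW1_mul_expand] at h0
  have d01 : ∀ s, W0m N m p s → ¬ Wmm N p s := fun s h1 h2 => by unfold W0m at h1; unfold Wmm at h2; omega
  refine ⟨?_, ?_⟩
  · have := congrArg (proj (K := K) (W0m N m p)) h0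
    rwa [map_add, map_smul, map_zero, proj_eq_self (fun s h => h) e0,
      proj_eq_zero (fun s h => fun h' => d01 s h' h) e1, smul_zero, add_zero] at this
  · intro ha
    have := congrArg (proj (K := K) (Wmm N p)) h0
    rwa [map_add, map_smul, map_zero, proj_eq_zero d01 e0, proj_eq_self (fun s h => h) e1, zero_add,
      smul_eq_zero, or_iff_right ha] at this

/-- a degree-`m` form killing `w₊` lies in `Hm`. -/
lemma mem_Hm_of_mul_block_eq_zero {m p : ℕ} {θ : HT K (In N)} (hθ : θ ∈ Hom K (In N) Finset.univ m)
    (h1 : θ * B K (In N) (Gm N p) = 0) : θ ∈ Hm K N m p := by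
  classical
  set P1 : Finset (In N) → Prop := fun s => s ⊆ Dm N p with hP1
  have hsplit1 := proj_add_proj_not (K := K) P1 θ
  have hθ1 : proj (K := K) P1 θ ∈ Alg K (In N) (Dm N p) :=
    Sp_mono (fun s hs => hs.2) (proj_mem_and (P := P1) hθ)
  have hθ1' : proj (K := K) (fun s => ¬ P1 s) θ ∈ Sp K (fun s => Degm N m s ∧ ¬ P1 s) := proj_mem_and hθ
  have hz1' : proj (K := K) (fun s => ¬ P1 s) θ * B K (In N) (Gm N p) = 0 := by
    refine mul_B_eq_zero_of_mem_Sp (fun s hs hd => ?_) hθ1'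
    obtain ⟨i, hi, hi'⟩ := Finset.not_subset.mp hs.2
    exact Finset.disjoint_left.mp hd hi (mem_Gm_of_not_mem_Dm hi')
  have hz1 : proj (K := K) P1 θ * B K (In N) (Gm N p) = 0 := by
    have := congrArg (· * B K (In N) (Gm N p)) hsplit1
    simp only [add_mul, hz1', add_zero, h1] at this
    exact this
  have hv1 : proj (K := K) P1 θ = 0 := eq_zero_of_mul_B_eq_zero K (disjoint_Dm_Gm p) hθ1 hz1
  rw [hv1, zero_add] at hsplit1
  rw [← hsplit1]
  exact Sp_mono (fun s hs => ⟨hs.1.2, hs.2⟩) hθ1'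

/-- forms in `Hm` kill `w₊`. -/
lemma mul_block_eq_zero_of_mem_Hm {m p : ℕ} {θ : HT K (In N)} (hθ : θ ∈ Hm K N m p) :
    θ * B K (In N) (Gm N p) = 0 := by
  refine mul_B_eq_zero_of_mem_Sp (fun s hs hd => ?_) hθ
  obtain ⟨i, hi, hi'⟩ := Finset.not_subset.mp hs.2
  exact Finset.disjoint_left.mp hd hi (mem_Gm_of_not_mem_Dm hi')

/-- structure of the kernel, one-sided: `Λ^m ⊓ ker(∧ v) = Hm ⊓ ker(∧ f)`. -/
theorem ker_eq_one {m p : ℕ} (hm : m + 1 ≤ N - p) (q : ℕ → K) {a : K} (ha : a ≠ 0) :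
    Hom K (In N) Finset.univ m ⊓ LinearMap.ker (LinearMap.mulRight K (vW1 K N p q a)) =
      Hm K N m p ⊓ LinearMap.ker (LinearMap.mulRight K (w K N N q)) := by
  ext θ
  simp only [Submodule.mem_inf, LinearMap.mem_ker, LinearMap.mulRight_apply]
  constructor
  · rintro ⟨hθ, h0⟩
    obtain ⟨hf, hmx⟩ := separation_one K hm q hθ h0
    exact ⟨mem_Hm_of_mul_block_eq_zero K hθ (hmx ha), hf⟩
  · rintro ⟨hθ, h0⟩
    refine ⟨Hm_le_Hom K m p hθ, ?_⟩
    rw [vW1_mul_expand, h0, mul_block_eq_zero_of_mem_Hm K hθ, smul_zero, add_zero]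

/-- `dim Hm + C(2p, m) = C(2N, m)`. -/
lemma finrank_Hm {m p : ℕ} (hp : p ≤ N) :
    Module.finrank K ↥(Hm K N m p) + (p + p).choose m = (N + N).choose m := by
  classical
  set U := (Finset.univ : Finset (In N)).powersetCard m with hU
  have h1 := Finset.card_filter_add_card_filter_not (s := U) (fun S => S ⊆ Dm N p)
  have e1 : U.filter (fun S => S ⊆ Dm N p) = (Dm N p).powersetCard m := by
    ext S
    simp only [hU, Finset.mem_filter, Finset.mem_powersetCard, Finset.subset_univ, true_and]
    tauto
  have hUc : U.card = (N + N).choose m := by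
    rw [hU, Finset.card_powersetCard, Finset.card_univ, Fintype.card_fin]
  have hf : Module.finrank K ↥(Hm K N m p) = (U.filter fun S => ¬ S ⊆ Dm N p).card := by
    rw [Hm, finrank_Sp]
    congr 1
    ext t
    simp only [Finset.mem_filter, Finset.mem_univ, true_and, Half, hU, Finset.mem_powersetCard_univ]
  rw [e1, Finset.card_powersetCard, card_Dm hp, hUc] at h1
  omega

/-- COUNT: `|HXm| + C(p,m) = C(N,m)`. -/
lemma card_HXm {m p : ℕ} (hp : p ≤ N) : (HXm N m p).card + p.choose m = N.choose m := by
  classical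
  rw [HXm]
  set U := (Finset.univ : Finset (Fin N)).powersetCard m with hU
  have h1 := Finset.card_filter_add_card_filter_not (s := U) (fun S => S ⊆ Ap N p)
  have e1 : U.filter (fun S => S ⊆ Ap N p) = (Ap N p).powersetCard m := by
    ext S
    simp only [hU, Finset.mem_filter, Finset.mem_powersetCard, Finset.subset_univ, true_and]
    tauto
  have hUc : U.card = N.choose m := by
    rw [hU, Finset.card_powersetCard, Finset.card_univ, Fintype.card_fin]
  rw [e1, Finset.card_powersetCard, card_Ap hp, hUc] at h1
  omega

/-- membership in `HXm`: size `m`, meets `Am`. -/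
lemma mem_HXm {m p : ℕ} {S : Finset (Fin N)} : S ∈ HXm N m p ↔ S.card = m ∧ ∃ b ∈ S, p ≤ (b : ℕ) := by
  rw [HXm, Finset.mem_filter, Finset.mem_powersetCard_univ, Finset.not_subset]
  simp only [mem_Ap, not_lt]

/-- `Hm ∧ f` is the sum of the selection pieces over `HXm`. -/
lemma map_f_Hm_eq {m p : ℕ} (q : ℕ → K) :
    (Hm K N m p).map (LinearMap.mulRight K (w K N N q)) =
      ⨆ S ∈ HXm N m p, (Sp K (Sel N S)).map (LinearMap.mulRight K (w K N N q)) := by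
  classical
  apply le_antisymm
  · rw [Submodule.map_le_iff_le_comap, Hm, Sp]
    apply Submodule.span_le.mpr
    rintro _ ⟨t, ⟨ht, h2⟩, rfl⟩
    rw [SetLike.mem_coe, Submodule.mem_comap, LinearMap.mulRight_apply]
    dsimp only
    rcases sel_or_pair (N := N) t with hsel | ⟨i, hi, hpi⟩
    · obtain ⟨j, hjt, hj⟩ := Finset.not_subset.mp h2
      have hS : t.image pr ∈ HXm N m p := by
        rw [mem_HXm]
        exact ⟨by rw [← ht]; exact hsel.1.symm, ⟨pr j, Finset.mem_image_of_mem pr hjt,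
          (mem_Gm_iff j).mp (mem_Gm_of_not_mem_Dm hj)⟩⟩
      have hmem : B K (In N) t * w K N N q ∈ (Sp K (Sel N (t.image pr))).map (LinearMap.mulRight K (w K N N q)) :=
        Submodule.mem_map_of_mem (B_mem_Sp hsel)
      exact le_biSup (fun S => (Sp K (Sel N S)).map (LinearMap.mulRight K (w K N N q))) hS hmem
    · rw [B_mul_f_eq_zero_of_pair K hi hpi]; exact Submodule.zero_mem _
  · refine iSup₂_le fun S hS => Submodule.map_mono ?_
    rw [mem_HXm] at hS
    obtain ⟨hS1, ⟨c, hcS, hc⟩⟩ := hS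
    refine Sp_mono fun t ht => ⟨ht.1.trans hS1, fun h => ?_⟩
    obtain ⟨i, hi, he⟩ := ht.exists_mem hcS
    have := (mem_Dm_iff i).mp (h hi)
    rw [he] at this; omega

/-- `dim (Hm ∧ f) = |HXm| · rank H_m(q)`. -/
lemma finrank_map_f_Hm {m p : ℕ} (q : ℕ → K) :
    Module.finrank K ↥((Hm K N m p).map (LinearMap.mulRight K (w K N N q))) =
      (HXm N m p).card * (hankel1 K N m q).rank := by
  classical
  have hHX : ∀ S ∈ HXm N m p, S.card = m := fun S hS => (mem_HXm.mp hS).1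
  rw [map_f_Hm_eq K q,
    finrank_biSup_eq_sum _ _ (fun S => Qpred N S) (fun S _ => map_f_Sel_le K S q)
      (fun S _ S' _ hSS' => Qpred_disjoint hSS'),
    Finset.sum_const_nat (m := (hankel1 K N m q).rank) (fun S hS => finrank_map_f_Sel K (hHX S hS) q)]

/-- **THEOREM R, ONE-SIDED (ε = 1), EVERY DEGREE m < N − p:**
`rank(⌟(f + a·w₊) ∣ HT^m) = C(2p,m) + (C(N,m) − C(p,m))·ρ_m`, additively. -/
theorem weilRank_one {m p : ℕ} (hm : m + 1 ≤ N - p) (q : ℕ → K) {a : K} (ha : a ≠ 0) :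
    Module.finrank K (LinearMap.range (wedge K N m (vW1 K N p q a))) + p.choose m * (hankel1 K N m q).rank =
      (p + p).choose m + N.choose m * (hankel1 K N m q).rank := by
  have hp : p ≤ N := by omega
  have H1 := finrank_eq_map_add_inf_ker K (Hom K (In N) Finset.univ m) (LinearMap.mulRight K (vW1 K N p q a))
  have H2 := finrank_eq_map_add_inf_ker K (Hm K N m p) (LinearMap.mulRight K (w K N N q))
  rw [ker_eq_one K hm q ha, finrank_Hom_univ, ← range_wedge] at H1
  rw [finrank_map_f_Hm K q] at H2
  have hM := finrank_Hm K (m := m) hp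
  have hHX := card_HXm (N := N) (m := m) hp
  have hI : N.choose m * (hankel1 K N m q).rank =
      (HXm N m p).card * (hankel1 K N m q).rank + p.choose m * (hankel1 K N m q).rank := by
    rw [← hHX]; ring
  omega

/-- **one-sided, Weil type (n,n), m < n:** `rank = C(2n,m)(1 + ρ_m) − ρ_m C(n,m)` (WEIL-CONE-RANK ε = 1; m = 2:
PART B §L.3 «n²ρ + (2n² − n) + C(n,2)ρ»). -/
theorem weilRank_nn_one {n m : ℕ} (hmn : m + 1 ≤ n) (q : ℕ → K) {a : K} (ha : a ≠ 0) :
    Module.finrank K (LinearMap.range (wedge K (n + n) m (vW1 K (n + n) n q a))) +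
        n.choose m * (hankel1 K (n + n) m q).rank =
      (n + n).choose m + (n + n).choose m * (hankel1 K (n + n) m q).rank := by
  exact weilRank_one K (N := n + n) (p := n) (m := m) (by omega) q ha

end OneSided

end Summit.Ventures.HSemireg.Wedge.Weil
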